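import Summits.AnomalousDissipation.AnomalousDissipation.Theses.LimitingAbsorption
import Summits.AnomalousDissipation.AnomalousDissipation.Theorems.RelaxingFamily.Negative.SublogBudget
import Summits.AnomalousDissipation.AnomalousDissipation.Theorems.UniformRelaxationWitness.Negative.SeisTransfer
import HarnessLib

/-!
# Sketch (ideator 6, crux-ideate round 2) — crux stmt-AnomalousDissipation-2937
`Summit.AnomalousDissipation.AnomalousDissipation.Theses.LimitingAbsorption.UniformRelaxationWitness` (X)

Typed content of this seat's round-2 output (see `NegativeNotesIdeator6R2.md` and the idea card
`Ideas/flux-loop-dichotomy.md` if filed):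

1. `KBLocality` — the KILL conjecture named explicitly (Kraichnan–Batchelor locality on bounded-energy
   invariant sets, in the tree's own currency = the hypothesis class of the LANDED
   `relaxingFamily_false_without_logEnstrophy_liminf`): every bounded-mean-energy steadily forced planar
   Leray–Hopf family admits homogeneous windowed strain budgets of slope `M_j` with
   `liminf_j M_j / log(1/ν_j) = 0`. PROVED here (plumbing): `KBLocality → ¬ RelaxingFamily → ¬ X`.
2. `PerpetualLogStrain` — the SCALAR-FREE CORE of X ("bounded-energy perpetual log-strain"): the
   necessary condition every positive line must first supply (strictly weaker than X: no scalar, no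
   floor). PROVED here: `KBLocality → ¬ PerpetualLogStrain` (so the crux's fate and its core's fate are
   the same dichotomy), and stated: `RelaxingFamily → PerpetualLogStrainLiminf` is the contrapositive
   reading of the landed liminf floor (not re-proved).
3. `LowerShellSink` — first checkable statement of the flux-loop structure lemma (for cdisprove):
   a two-shell witness does NEGATIVE mean work on its lower forcing shell at every deep level
   (energy + enstrophy balance + `Z² ≤ E·P`); typed as a `_false_without_` class, proof = M-sized, not
   attempted here.
-/

noncomputable section

open MeasureTheory Set Filter Function TopologicalSpace Topology
open scoped ENNReal NNReal InnerProductSpace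
open Literature.Analysis.FunctionSpaces Literature.Analysis.FunctionSpaces.Torus
open Literature.Analysis.FluidPDE Literature.Analysis.FluidPDE.Torus
open Summit.AnomalousDissipation.AnomalousDissipation.Theses.LimitingAbsorption
open Summit.AnomalousDissipation.AnomalousDissipation.Theorems.RelaxingFamily.Negative
open Summit.AnomalousDissipation.AnomalousDissipation.Theorems.UniformRelaxationWitness.Negative

-- D-0017: single-problem summit ⇒ `Summit.AnomalousDissipation.AnomalousDissipation.…` by design.
set_option linter.dupNamespace false

namespace Summit.AnomalousDissipation.AnomalousDissipation.Cruxes.UniformRelaxationWitness.Ideator6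

/-- The unit flat 2-torus (local notation). -/
local notation "𝕋²" => UnitAddTorus (Fin 2)
/-- Planar vectors (local notation). -/
local notation "E²" => EuclideanSpace ℝ (Fin 2)

/-! ## 1. The kill conjecture, named: Kraichnan–Batchelor locality on bounded-energy families -/

/-- **KBLocality** (conjecture; the physically expected truth, Kraichnan 1971 / Batchelor 1969:
bounded energy ⇒ bounded enstrophy injection ⇒ log-corrected `k⁻³` range ⇒ windowed strain
`≍ log^{1/3}(1/ν) = o(log(1/ν))`). In the tree's currency: EVERY bounded-mean-energy, steadily forced
planar Leray–Hopf family along `ν_j → 0` admits level-dependent slopes `M_j ≥ 1`, sub-logarithmic along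
some subsequence (`∀ ε > 0, ∃ᶠ j, M_j / log(1/ν_j) < ε`), and phases `s_j ≥ 0` with the homogeneous
windowed strain budget `∫₀ᵗ ‖∇v_j(s_j+τ)‖_{L²} dτ ≤ M_j t` for all `t > 0` — verbatim the hypothesis
class of `relaxingFamily_false_without_logEnstrophy_liminf`. Rigorous status: OPEN (available:
`⟨‖∇v‖²⟩ ≲ ν^{-1/2}`, Alexakis–Doering; needed: `o(log²)`). [conjecture] -/
def KBLocality : Prop :=
  ∀ (g : 𝕋² → E²), IsSmooth g → IsDivFree g → HasZeroMean g →
  ∀ (ν : ℕ → ℝ) (v₀ : ℕ → 𝕋² → E²) (v : ℕ → ℝ → 𝕋² → E²),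
    (∀ j, 0 < ν j) → Tendsto ν atTop (𝓝 0) →
    (∀ j, IsGlobalLerayHopf (ν j) (fun _ => g) (v₀ j) (v j)) →
    (∃ E : ℝ, ∀ j, meanEnergy (v j) ≤ E) →
    ∃ M : ℕ → ℝ, (∀ j, 1 ≤ M j) ∧
      (∀ ε : ℝ, 0 < ε → ∃ᶠ j in atTop, M j / Real.log (ν j)⁻¹ < ε) ∧
      ∀ j : ℕ, ∃ s : ℝ, 0 ≤ s ∧ ∀ t : ℝ, 0 < t →
        ∫⁻ τ in Ioo 0 t, eGradNormSq (v j (s + τ)) ^ (1 / 2 : ℝ) ≤ ENNReal.ofReal (M j * t)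

/-- **KBLocality kills crux r3** (plumbing over the landed liminf Seis floor). [folklore] -/
theorem not_relaxingFamily_of_kbLocality (hKB : KBLocality) : ¬ RelaxingFamily := by
  intro hR
  refine relaxingFamily_false_without_logEnstrophy_liminf ?_
  obtain ⟨g, h, hg, hgd, hgm, hh, hhm, hh0, ν, v₀, v, hν, hνlim, hLH, hbd, hE, -, C, γ, hC, hγ,
    hrelax⟩ := relaxingFamilyUnder_true_iff.2 hR
  exact ⟨g, h, hg, hgd, hgm, hh, hhm, hh0, ν, v₀, v, hν, hνlim, hLH, hbd, hE,
    hKB g hg hgd hgm ν v₀ v hν hνlim hLH hE, C, γ, hC, hγ, hrelax⟩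

/-- **KBLocality kills the crux X** (`¬ RelaxingFamily → ¬ X`, landed Part A). [folklore] -/
theorem not_uniformRelaxationWitness_of_kbLocality (hKB : KBLocality) : ¬ UniformRelaxationWitness :=
  uniformRelaxationWitness_false_of_not_relaxingFamily (not_relaxingFamily_of_kbLocality hKB)

/-! ## 2. The scalar-free core of X: bounded-energy perpetual log-strain -/

/-- **PerpetualLogStrain** (the scalar-free core of X; strictly weaker than X — no scalar, no floor):
a smooth steady div-free mean-zero `g`, `ν_j → 0` and global planar Leray–Hopf solutions `v_j` with
`sup_j meanEnergy(v_j) ≤ E` whose windowed strain on EVERY window of one fixed length `L` from EVERY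
phase is at least `c L log(1/ν_j)`: "steadily forced 2-D Navier–Stokes at bounded energy can keep its
strain at the Seis threshold for ever". Physically: Kraichnan–Batchelor gives `log^{1/3}`, not `log`
(so this is expected FALSE for generic data; data selection is free). Every positive line for X must
supply this first (landed: `relaxingFamily_false_without_logEnstrophy_liminf`). [conjecture] -/
def PerpetualLogStrain : Prop :=
  ∃ (g : 𝕋² → E²), IsSmooth g ∧ IsDivFree g ∧ HasZeroMean g ∧
  ∃ (ν : ℕ → ℝ) (v₀ : ℕ → 𝕋² → E²) (v : ℕ → ℝ → 𝕋² → E²),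
    (∀ j, 0 < ν j) ∧ Tendsto ν atTop (𝓝 0) ∧
    (∀ j, IsGlobalLerayHopf (ν j) (fun _ => g) (v₀ j) (v j)) ∧
    (∃ E : ℝ, ∀ j, meanEnergy (v j) ≤ E) ∧
    ∃ c L : ℝ, 0 < c ∧ 0 < L ∧ ∀ (j : ℕ) (s : ℝ), 0 ≤ s →
      ENNReal.ofReal (c * L * Real.log (ν j)⁻¹) ≤
        ∫⁻ τ in Ioo 0 L, eGradNormSq (v j (s + τ)) ^ (1 / 2 : ℝ)

/-- **The core and the crux share one dichotomy**: `KBLocality → ¬ PerpetualLogStrain`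
(a homogeneous budget of slope `M_j` from phase `s_j` and the floor on the window `[s_j, s_j + L]`
give `c ≤ M_j / log(1/ν_j)`, which is `< c` at some level). [folklore] -/
theorem not_perpetualLogStrain_of_kbLocality (hKB : KBLocality) : ¬ PerpetualLogStrain := by
  rintro ⟨g, hg, hgd, hgm, ν, v₀, v, hν, hνlim, hLH, hE, c, L, hc, hL, hfloor⟩
  obtain ⟨M, hM1, hfreq, hbud⟩ := hKB g hg hgd hgm ν v₀ v hν hνlim hLH hE
  -- a level with `M_j / log(1/ν_j) < c` and `ν_j < 1`
  have hev : ∀ᶠ j in atTop, ν j < 1 := hνlim.eventually (gt_mem_nhds one_pos)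
  obtain ⟨j, hjc, hjν⟩ := ((hfreq c hc).and_eventually hev).exists
  obtain ⟨s, hs, hb⟩ := hbud j
  have hlogpos : 0 < Real.log (ν j)⁻¹ := Real.log_pos ((one_lt_inv₀ (hν j)).2 hjν)
  -- floor on the window from phase `s`, budget on the same window
  have h1 := (hfloor j s hs).trans (hb L hL)
  have h2 : c * L * Real.log (ν j)⁻¹ ≤ M j * L := by
    have := (ENNReal.ofReal_le_ofReal_iff (by nlinarith [hM1 j])).1 h1
    exact this
  have h3 : c * Real.log (ν j)⁻¹ ≤ M j := by
    have : L * (c * Real.log (ν j)⁻¹) ≤ L * M j := by nlinarith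
    exact le_of_mul_le_mul_left this hL
  have h4 : c ≤ M j / Real.log (ν j)⁻¹ := by
    rw [le_div_iff₀ hlogpos]; exact h3
  exact absurd (h4.trans_lt hjc) (lt_irrefl _)

/-! ## 3. Flux-loop structure: the lower forcing shell of a two-shell witness is an energy sink -/

/-- `g` lives on ONE Fourier shell `|k|² = m`. -/
def OnShell (g : 𝕋² → E²) (m : ℝ) : Prop :=
  ∀ k : Fin 2 → ℤ, freqNormSq k ≠ m → UnitAddTorus.mFourierCoeff (EuclideanSpace.complexify ∘ g) k = 0

/-- Long-time mean (`limsup` of Cesàro means, the tree's `longTimeAvgSup`) of the WORK done by the force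
component `g₁` on the flow `u`: `⟨(g₁, u)⟩`. -/
def workMean (g₁ : 𝕋² → E²) (u : ℝ → 𝕋² → E²) : ℝ :=
  longTimeAvgSup (fun t => ∫ x, ⟪g₁ x, u t x⟫_ℝ)

/-- **Two-shell witnesses with a non-negative lower-shell work at infinitely many levels** — the
class the sink-sign lemma excludes. `g = g₁ + g₂`, `gᵢ` smooth div-free mean-zero on shells
`0 < m₁ < m₂`, and `⟨(g₁, v_j)⟩ ≥ 0` frequently in `j`. -/
def NonnegativeLowerShellWork (g : 𝕋² → E²) (_h : 𝕋² → ℝ) (_ν : ℕ → ℝ)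
    (v : ℕ → ℝ → 𝕋² → E²) : Prop :=
  ∃ (g₁ g₂ : 𝕋² → E²) (m₁ m₂ : ℝ), 0 < m₁ ∧ m₁ < m₂ ∧ g = g₁ + g₂ ∧
    IsSmooth g₁ ∧ IsDivFree g₁ ∧ HasZeroMean g₁ ∧ OnShell g₁ m₁ ∧
    IsSmooth g₂ ∧ IsDivFree g₂ ∧ HasZeroMean g₂ ∧ OnShell g₂ m₂ ∧
    ∃ᶠ j in atTop, 0 ≤ workMean g₁ (v j)

/-- **SINK-SIGN LEMMA (statement; first checkable lemma of the flux-loop structure, for cdisprove).**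
No witness of crux r3 (hence of X) forced on exactly two shells does non-negative mean work on its
LOWER shell at infinitely many levels: at every deep level the lower shell is an energy SINK.
Paper proof (finite-`T` Cesàro means, then `limsup`): 2-D Leray–Hopf energy equality
`ν z_T = a₁ + a₂ + (E(0) − E(T))/2T`, enstrophy balance from a positive time
`ν p_T ≥ 4π²(m₁ a₁ + m₂ a₂) − Z(t₀)/2T` (`fmrt_enstrophy_balance_torus2`; `(−Δgᵢ, v) = 4π²mᵢ (gᵢ, v)` on
a shell), interpolation `z_T² ≤ e_T p_T` (`AlexakisDoering2006_dissipation_sq_le`), whence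
`4π²(m₂ − m₁) a₁(T) ≤ ν z_T (4π² m₂ − z_T / e_T) + o(1)`; the landed liminf Seis floor
(`relaxingFamily_false_without_logEnstrophy_liminf`) makes `z_T ≥ c² log²(1/ν_j)` on every window at
all deep levels while `e_T ≤ E + 1` eventually, so `limsup_T a₁(T) < 0`. Size: M (Cesàro/limsup
bookkeeping as in `Negative/SingleShell.lean`). [conjecture] -/
def LowerShellSink : Prop := ¬ RelaxingFamilyUnder NonnegativeLowerShellWork

/-- The X-form follows from the r3-form by the landed Part A transfer (`UniformRelaxationWitnessUnder`
is the Disproof's receptacle; stated here over `RelaxingFamilyUnder` only). [folklore] -/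
theorem lowerShellSink_binds_X (hS : LowerShellSink) :
    ¬ UniformRelaxationWitnessUnder NonnegativeLowerShellWork := fun hX =>
  hS hX.relaxingFamilyUnder

end Summit.AnomalousDissipation.AnomalousDissipation.Cruxes.UniformRelaxationWitness.Ideator6

end
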